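import Summits.Schanuel.Schanuel.Theorems.RootDecomp1KKummerFactors

/-!
# RootDecomp1KKummerIndependence — §22 REV D «KummerCells» port, part 3/4 (lens 6, gen 10 = ROUND 5 theorem round of route-Schanuel-RootDecomp1K on A₄ʰ stmt-Schanuel-33363)

Mechanical port (census-1 gen 8; tools tools/build_dark.py over census/tools/gen7/portkit2.py) of §22 of HOME/decomp-schanuel-lens-6/g10/addendum/KummerCells.lean
(sha256 228dad56…, 9085 l; critic VERDICT 2026-08-30T17:19:03Z ACCEPTED — THEOREM ROUND, PATH T, census C-7) on top of the §17 wave Theorems/RootDecomp1KHyper01…19.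
This part: node lines 8581–8895 (1 declarations: kummer_aeval_ne_zero').
The node-local named fact `NWThm1` is replaced by the registered Literature fact
`Literature.NumberTheory.Transcendental.NesterenkoWaldschmidt1996_thm_1` (token-identical body); statements and proofs
are otherwise the node's verbatim, in the wave namespace `Summit.Schanuel.Schanuel.Theorems.RootDecomp1KHyper` (sub-namespace `HyperCell`).
`--supports stmt-Schanuel-33363` (A₄ʰ HyperLiouvilleSchanuel: decided n = 2, 3 cells at every Kummer anchor s·log 2, s ∈ ℚ^× (ρ hyper-Liouville), mod the registered fact NW96 Thm 1 alone). Sorry-free; standard axioms. Nothing here proves Schanuel; rung 0.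
-/

set_option linter.dupNamespace false
set_option linter.unusedSectionVars false

noncomputable section

open Complex IntermediateField Filter Polynomial
open Literature.NumberTheory.Transcendental (NesterenkoWaldschmidt1996_thm_1)

namespace Summit.Schanuel.Schanuel.Theorems.RootDecomp1KHyper

variable {n K : ℕ}

namespace HyperCell

variable {n K : ℕ}

/-- §21h. Length and height bookkeeping: auxiliary statement `len_le_two_pow_mul_mahlerMeasure` (lens 6 gen 10 node, ported verbatim). -/
private theorem len_le_two_pow_mul_mahlerMeasure (S : ℤ[X]) :
    (len S : ℝ) ≤ 2 ^ S.natDegree * (S.map (Int.castRingHom ℂ)).mahlerMeasure := by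
  have hdeg : (S.map (Int.castRingHom ℂ)).natDegree = S.natDegree :=
    natDegree_map_eq_of_injective (RingHom.injective_int _) S
  unfold len
  push_cast
  calc ∑ k ∈ Finset.range (S.natDegree + 1), |((S.coeff k : ℤ) : ℝ)|
      = ∑ k ∈ Finset.range (S.natDegree + 1), ‖(S.map (Int.castRingHom ℂ)).coeff k‖ := by
        refine Finset.sum_congr rfl fun k _ => ?_
        rw [Polynomial.coeff_map, eq_intCast, Complex.norm_intCast]
    _ ≤ ∑ k ∈ Finset.range (S.natDegree + 1),
          ((S.natDegree.choose k : ℕ) : ℝ) * (S.map (Int.castRingHom ℂ)).mahlerMeasure := by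
        refine Finset.sum_le_sum fun k _ => ?_
        have := norm_coeff_le_choose_mul_mahlerMeasure k (S.map (Int.castRingHom ℂ))
        rwa [hdeg] at this
    _ = 2 ^ S.natDegree * (S.map (Int.castRingHom ℂ)).mahlerMeasure := by
        rw [← Finset.sum_mul]
        congr 1
        exact_mod_cast Nat.sum_range_choose S.natDegree

set_option maxHeartbeats 2000000 in
/-- **Kummer extraction.** For a hyper-Liouville real `ρ > 0`, the numbers `ρ, log 2, 2^ρ` satisfy no
non-trivial integer polynomial relation — modulo the REGISTERED fact NW 1996 Theorem 1.  PROOF: as the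
torsion extraction (§21) with the cyclotomic polynomial replaced by the Kummer polynomial `X^q − 2^p`
(`p/q` a super-approximant of `ρ`; its roots `ζ 2^{p/q}` have degree `≥ q` over `ℚ` since `gcd(p,q)=1`,
§22a) and `π`'s measure replaced by the transcendence measure of `log 2` obtained from Theorem 1 by
transference (§22f): `|S(log 2)| ≥ exp(−A₃ q⁶)` against the tiny factor `< exp(A₁q²) e^{−q⁷}`. -/
theorem kummer_aeval_ne_zero' (hNW : NesterenkoWaldschmidt1996_thm_1) {ρ : ℝ} (hρ : HyperLiouville ρ) (hρ0 : 0 < ρ)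
    (P : MvPolynomial (Fin 3) ℤ) (hP : P ≠ 0) :
    MvPolynomial.aeval
      ![(ρ : ℂ), ((Real.log 2 : ℝ) : ℂ), cexp (((Real.log 2 : ℝ) : ℂ) * (ρ : ℂ))] P ≠ 0 := by
  classical
  intro hP0
  have hlog2 : 0 < Real.log 2 := Real.log_pos (by norm_num)
  have hlog2' : Real.log 2 ≤ 1 := by linarith [Real.log_two_lt_d9]
  -- data of `P`
  have hsupp : P.support.Nonempty :=
    Finset.nonempty_iff_ne_empty.mpr fun h => hP (MvPolynomial.support_eq_empty.mp h)
  obtain ⟨s₀, hs₀⟩ := hsupp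
  obtain ⟨D, hDdef⟩ : ∃ D : ℕ, D = P.support.sup (fun s => s 0) := ⟨_, rfl⟩
  obtain ⟨K, hKdef⟩ : ∃ K : ℕ, K = P.support.sup (fun s => s 1) := ⟨_, rfl⟩
  obtain ⟨N, hNdef⟩ : ∃ N : ℕ, N = P.support.sup (fun s => s 2) := ⟨_, rfl⟩
  have hD : ∀ s ∈ P.support, s 0 ≤ D := fun s hs =>
    hDdef ▸ Finset.le_sup (f := fun s : Fin 3 →₀ ℕ => s 0) hs
  have hK : ∀ s ∈ P.support, s 1 ≤ K := fun s hs =>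
    hKdef ▸ Finset.le_sup (f := fun s : Fin 3 →₀ ℕ => s 1) hs
  have hN : ∀ s ∈ P.support, s 2 ≤ N := fun s hs =>
    hNdef ▸ Finset.le_sup (f := fun s : Fin 3 →₀ ℕ => s 2) hs
  obtain ⟨Kl, δ₁, hKl0, hδ₁, hlip⟩ := exists_lipschitz_kumF P ρ
  have hFρ : kumF P ρ = 0 := by rw [kumF_eq_aeval]; exact hP0
  -- constants
  obtain ⟨R₂, hR₂⟩ : ∃ R₂ : ℝ, R₂ = (2 : ℝ) ^ (|ρ| + 1) := ⟨_, rfl⟩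
  have hR₂1 : 1 ≤ R₂ := by
    rw [hR₂]; exact Real.one_le_rpow (by norm_num) (by linarith [abs_nonneg ρ])
  have hR₂0 : 0 ≤ R₂ := by linarith
  obtain ⟨B, hB⟩ : ∃ B : ℝ, B = ∑ s ∈ P.support,
      ((|P.coeff s| : ℤ) : ℝ) * ((|ρ| + 1) ^ (s 0) * 1 ^ (s 1) * R₂ ^ (s 2)) := ⟨_, rfl⟩
  have hB0 : 0 ≤ B := by
    rw [hB]; exact Finset.sum_nonneg fun s _ => by positivity
  obtain ⟨B', hB'⟩ : ∃ B' : ℝ, B' = max 1 B := ⟨_, rfl⟩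
  have hB'1 : 1 ≤ B' := hB' ▸ le_max_left _ _
  have hBB' : B ≤ B' := hB' ▸ le_max_right _ _
  obtain ⟨A, hA⟩ : ∃ A : ℝ,
      A = ((K : ℝ) + 1) * (((N : ℝ) + 1) * ((cP P : ℝ) * (|ρ| + 2) ^ D)) := ⟨_, rfl⟩
  have hcP1 : (1 : ℝ) ≤ cP P := by exact_mod_cast one_le_cP hs₀
  have hK0 : (0 : ℝ) ≤ K := Nat.cast_nonneg K
  have hN0 : (0 : ℝ) ≤ N := Nat.cast_nonneg N
  have hD0 : (0 : ℝ) ≤ D := Nat.cast_nonneg D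
  have hA1 : 1 ≤ A := by
    rw [hA]
    have h3 : (1 : ℝ) ≤ (|ρ| + 2) ^ D := one_le_pow₀ (by linarith [abs_nonneg ρ])
    calc (1 : ℝ) = 1 * (1 * (1 * 1)) := by ring
      _ ≤ ((K : ℝ) + 1) * (((N : ℝ) + 1) * ((cP P : ℝ) * (|ρ| + 2) ^ D)) := by
          gcongr <;> linarith
  obtain ⟨A₁, hA₁⟩ : ∃ A₁ : ℝ, A₁ = 2 * D + B' + Kl + 1 := ⟨_, rfl⟩
  obtain ⟨A₂, hA₂⟩ : ∃ A₂ : ℝ, A₂ = 2 + ((K : ℝ) + 1) + A + D + N * (|ρ| + 1) := ⟨_, rfl⟩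
  obtain ⟨A₃, hA₃⟩ : ∃ A₃ : ℝ,
      A₃ = ((K : ℝ) + 1) * (211 * (A₂ + 5 * ((K : ℝ) + 1) + 13) * (2 * ((K : ℝ) + 1) + 10) *
        (4 * ((K : ℝ) + 1) ^ 2 + 7 * ((K : ℝ) + 1) + 1) + (A₂ + ((K : ℝ) + 1) + 1)) := ⟨_, rfl⟩
  have hA₁0 : 0 ≤ A₁ := by rw [hA₁]; linarith
  have hNρ : 0 ≤ (N : ℝ) * (|ρ| + 1) := by positivity
  have hA₂0 : 0 ≤ A₂ := by rw [hA₂]; linarith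
  have hA₃0 : 0 ≤ A₃ := by rw [hA₃]; positivity
  -- threshold and the super-approximant
  obtain ⟨q₀, hq₀def⟩ : ∃ q₀ : ℕ, q₀ = max (max (max 3 (denBound (torD P (s₀ 1) (s₀ 2))))
      (max (N + 1) (⌈1 / δ₁⌉₊ + 1))) (max (⌈A₁ + A₃⌉₊ + 1) (⌈1 / ρ⌉₊ + 1)) := ⟨_, rfl⟩
  obtain ⟨r, hden, hρr, hη⟩ := hρ (max 7 q₀)
  have hq₀q : q₀ ≤ r.den := le_trans (le_max_right _ _) hden
  have hq7 : 7 ≤ max 7 q₀ := le_max_left _ _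
  have hqden : denBound (torD P (s₀ 1) (s₀ 2)) ≤ r.den := by rw [hq₀def] at hq₀q; omega
  have hqN : N < r.den := by rw [hq₀def] at hq₀q; omega
  have hqδ : ⌈1 / δ₁⌉₊ + 1 ≤ r.den := by rw [hq₀def] at hq₀q; omega
  have hqA : ⌈A₁ + A₃⌉₊ + 1 ≤ r.den := by rw [hq₀def] at hq₀q; omega
  have hqρ : ⌈1 / ρ⌉₊ + 1 ≤ r.den := by rw [hq₀def] at hq₀q; omega
  have hqpos : 0 < r.den := r.den_pos
  have hq0 : r.den ≠ 0 := r.den_nz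
  obtain ⟨Q, hQ⟩ : ∃ Q : ℝ, Q = (r.den : ℝ) := ⟨_, rfl⟩
  have hQ1 : (1 : ℝ) ≤ Q := by rw [hQ]; exact_mod_cast hqpos
  have hQ0 : (0 : ℝ) < Q := by linarith
  -- the approximation `η = |ρ − r|`
  obtain ⟨η, hηdef⟩ : ∃ η : ℝ, η = |ρ - r| := ⟨_, rfl⟩
  rw [← hηdef, ← hQ] at hη
  have hη0 : 0 < η := by rw [hηdef]; exact abs_pos.mpr (sub_ne_zero.mpr hρr)
  have hη7 : η < Real.exp (-(Q ^ 7)) := by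
    refine hη.trans_le (Real.exp_le_exp.mpr ?_)
    rw [neg_le_neg_iff]
    exact pow_le_pow_right₀ hQ1 hq7
  have hη1 : η < 1 := by
    refine hη7.trans_le ?_
    rw [← Real.exp_zero]
    exact Real.exp_le_exp.mpr (by rw [neg_nonpos]; positivity)
  have hηδ : η < δ₁ := eta_lt_delta hQ1 hδ₁ (by rw [hQ]; exact_mod_cast hqδ) hη7
  have hηρ : η < ρ := eta_lt_delta hQ1 hρ0 (by rw [hQ]; exact_mod_cast hqρ) hη7
  -- `r > 0`, numerator `p = pn > 0` coprime to `q`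
  have hr0 : (0 : ℝ) < r := by
    have : ρ - r ≤ η := by rw [hηdef]; exact le_abs_self _
    linarith
  have hr0' : 0 < r := by exact_mod_cast hr0
  have hnum0 : 0 < r.num := Rat.num_pos.mpr hr0'
  obtain ⟨pn, hpn⟩ : ∃ pn : ℕ, pn = r.num.natAbs := ⟨_, rfl⟩
  have hpnZ : (pn : ℤ) = r.num := by rw [hpn]; exact Int.natAbs_of_nonneg hnum0.le
  have hcop : Nat.Coprime pn r.den := by rw [hpn]; exact r.reduced
  -- `|r| ≤ |ρ| + 1`, `p ≤ (|ρ| + 1) q`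
  have hrabs : |(r : ℝ)| ≤ |ρ| + 1 := by
    have h1 : |(r : ℝ)| ≤ |ρ| + |ρ - r| := by
      have := abs_sub_abs_le_abs_sub (r : ℝ) ρ
      rw [abs_sub_comm] at this
      linarith
    rw [← hηdef] at h1
    linarith
  have hpabs : |(r.num : ℝ)| ≤ (|ρ| + 1) * Q := by
    have e : (r : ℝ) = (r.num : ℝ) / (r.den : ℝ) := by exact_mod_cast (Rat.num_div_den r).symm
    have h := hrabs
    rw [e, abs_div, Nat.abs_cast, div_le_iff₀ (by exact_mod_cast hqpos : (0 : ℝ) < r.den), ← hQ] at h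
    exact h
  have hpnQ : (pn : ℝ) ≤ (|ρ| + 1) * Q := by
    have : (pn : ℝ) = |(r.num : ℝ)| := by
      rw [hpn, Nat.cast_natAbs, Int.cast_abs]
    rw [this]; exact hpabs
  -- the Kummer polynomial `f = X^q − 2^pn` and its complex roots
  obtain ⟨f, hfdef⟩ : ∃ f : ℤ[X], f = X ^ r.den - C ((2 : ℤ) ^ pn) := ⟨_, rfl⟩
  have hfmonic : f.Monic := hfdef ▸ monic_X_pow_sub_C _ hq0
  have hf0 : f ≠ 0 := hfmonic.ne_zero
  have hfdeg : f.natDegree = r.den := by rw [hfdef, natDegree_X_pow_sub_C]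
  have hfC : f.map (Int.castRingHom ℂ) = X ^ r.den - C ((2 : ℂ) ^ pn) :=
    hfdef ▸ map_X_pow_sub_C_two_pow r.den pn
  have hfC0 : f.map (Int.castRingHom ℂ) ≠ 0 :=
    (Polynomial.map_ne_zero_iff (RingHom.injective_int _)).mpr hf0
  have hlead : (f.map (Int.castRingHom ℂ)).leadingCoeff = 1 := (hfmonic.map _).leadingCoeff
  have hmem_roots : ∀ b : ℂ, b ∈ (f.map (Int.castRingHom ℂ)).roots ↔ b ^ r.den = (2 : ℂ) ^ pn := by
    intro b
    rw [mem_roots hfC0, IsRoot.def, hfC, eval_sub, eval_pow, eval_X, eval_C, sub_eq_zero]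
  have hcard : Multiset.card (f.map (Int.castRingHom ℂ)).roots ≤ r.den := by
    refine (card_roots' _).trans ?_
    rw [hfC, natDegree_X_pow_sub_C]
  -- norms of the roots
  have hR₂q : (2 : ℝ) ^ pn ≤ R₂ ^ r.den := by
    rw [hR₂, ← Real.rpow_mul_natCast (by norm_num : (0 : ℝ) ≤ 2), ← Real.rpow_natCast 2 pn, ← hQ]
    exact Real.rpow_le_rpow_of_exponent_le (by norm_num) hpnQ
  have hroot_norm : ∀ b ∈ (f.map (Int.castRingHom ℂ)).roots, ‖b‖ ≤ R₂ := by
    intro b hb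
    have hbq := (hmem_roots b).mp hb
    have h1 : ‖b‖ ^ r.den = (2 : ℝ) ^ pn := by
      have := congrArg norm hbq
      rwa [norm_pow, norm_pow, Complex.norm_two] at this
    have h2 : ‖b‖ ^ r.den ≤ R₂ ^ r.den := h1 ▸ hR₂q
    exact (pow_le_pow_iff_left₀ (norm_nonneg _) hR₂0 hq0).mp h2
  -- the family `G` and the eliminant `S`
  obtain ⟨G, hGdef⟩ : ∃ G : Fin (K + 1) → ℤ[X], G = torG P D r.num r.den K := ⟨_, rfl⟩
  have hGN : ∀ k, (G k).natDegree ≤ N := fun k =>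
    hGdef ▸ natDegree_torG_le P D r.num r.den K hN k
  obtain ⟨S, hSdef⟩ : ∃ S : ℤ[X], S = resPoly f G N := ⟨_, rfl⟩
  have hs₀K : s₀ 1 ≤ K := hK s₀ hs₀
  have hne : ∀ b ∈ (f.map (Int.castRingHom ℂ)).roots, conjFactor G b ≠ 0 := by
    intro b hb
    rw [hGdef]
    exact conjFactor_torG_ne_zero_kummer hD hN hs₀ hs₀K r rfl rfl hqden hqN hcop
      ((hmem_roots b).mp hb)
  have hS0 : S ≠ 0 := hSdef ▸ resPoly_ne_zero' f hf0 G hGN hne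
  -- (L) the lower bound from the transcendence measure of `log 2`
  obtain ⟨d, hd⟩ : ∃ d : ℕ, d = r.den * K + 1 := ⟨_, rfl⟩
  have hd1 : 1 ≤ d := by omega
  have hdegS : S.natDegree ≤ d := by
    rw [hSdef, hd]
    refine (natDegree_resPoly_le f G hGN).trans ?_
    rw [hfdeg]; exact Nat.le_succ _
  have hdQ : (d : ℝ) ≤ ((K : ℝ) + 1) * Q := by
    rw [hd, hQ]; push_cast; nlinarith
  have hrelLen : relLen G ≤ A * Q ^ D := by
    rw [hGdef]
    refine (relLen_torG_le P D r.num r.den hD hN).trans ?_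
    rw [hA, ← hQ]
    have h1 : (|(r.num : ℝ)| + Q) ^ D ≤ ((|ρ| + 2) * Q) ^ D := by
      apply pow_le_pow_left₀ (by positivity)
      linarith
    rw [mul_pow] at h1
    have hc0 : (0 : ℝ) ≤ (cP P : ℝ) := by linarith
    calc ((K : ℝ) + 1) * (((N : ℝ) + 1) * ((cP P : ℝ) * (|(r.num : ℝ)| + Q) ^ D))
        ≤ ((K : ℝ) + 1) * (((N : ℝ) + 1) * ((cP P : ℝ) * ((|ρ| + 2) ^ D * Q ^ D))) := by
          gcongr
      _ = ((K : ℝ) + 1) * (((N : ℝ) + 1) * ((cP P : ℝ) * (|ρ| + 2) ^ D)) * Q ^ D := by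
          ring
  have hAQ1 : 1 ≤ A * Q ^ D := one_le_mul_of_one_le_of_one_le hA1 (one_le_pow₀ hQ1)
  -- Mahler measure of `f`: `≤ R₂^q`
  have hMf : (f.map (Int.castRingHom ℂ)).mahlerMeasure ≤ R₂ ^ r.den := by
    rw [mahlerMeasure_eq_leadingCoeff_mul_prod_roots, hlead, norm_one, one_mul]
    refine (multiset_map_prod_le (fun b : ℂ => max 1 ‖b‖) _ (fun b _ => by positivity)
      (fun b hb => max_le hR₂1 (hroot_norm b hb))).trans ?_
    exact pow_le_pow_right₀ hR₂1 hcard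
  have hMf0 : 0 ≤ (f.map (Int.castRingHom ℂ)).mahlerMeasure := mahlerMeasure_nonneg _
  obtain ⟨W, hW⟩ : ∃ W : ℝ, W = (R₂ ^ r.den) ^ N := ⟨_, rfl⟩
  have hW1 : 1 ≤ W := hW ▸ one_le_pow₀ (one_le_pow₀ hR₂1)
  have hlenS : (len S : ℝ) ≤ 2 ^ d * (A * Q ^ D) ^ r.den * W := by
    refine (len_le_two_pow_mul_mahlerMeasure S).trans ?_
    have h1 : (2 : ℝ) ^ S.natDegree ≤ 2 ^ d := pow_le_pow_right₀ (by norm_num) hdegS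
    have h2 : (S.map (Int.castRingHom ℂ)).mahlerMeasure ≤ (A * Q ^ D) ^ r.den * W := by
      rw [hSdef, hW]
      refine (mahlerMeasure_resPoly_le f hf0 G hGN).trans ?_
      rw [hfdeg]
      exact mul_le_mul (pow_le_pow_left₀ (relLen_nonneg G) hrelLen _)
        (pow_le_pow_left₀ hMf0 hMf _) (by positivity) (by positivity)
    rw [mul_assoc]
    exact mul_le_mul h1 h2 (mahlerMeasure_nonneg _) (by positivity)
  obtain ⟨Λ, hΛ⟩ : ∃ Λ : ℝ, Λ = 2 ^ d * (A * Q ^ D) ^ r.den * W + 3 := ⟨_, rfl⟩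
  have hΛlen : (len S : ℝ) + 3 ≤ Λ := by rw [hΛ]; linarith
  have hlow := log2_measure' hNW S hS0 hd1 hdegS hΛlen
  -- (L') the exponent is at most `A₃ Q⁶`
  have hlogW : Real.log W ≤ (N : ℝ) * (|ρ| + 1) * Q ^ 2 := by
    rw [hW, ← pow_mul, Real.log_pow, hR₂, Real.log_rpow (by norm_num : (0 : ℝ) < 2)]
    push_cast
    rw [← hQ]
    have h1 : (|ρ| + 1) * Real.log 2 ≤ (|ρ| + 1) := by
      have := mul_le_mul_of_nonneg_left hlog2' (by linarith [abs_nonneg ρ] : (0 : ℝ) ≤ |ρ| + 1)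
      linarith
    have hQQ : Q * N ≤ Q ^ 2 * N := mul_le_mul_of_nonneg_right (by nlinarith) hN0
    calc Q * N * ((|ρ| + 1) * Real.log 2) ≤ Q * N * (|ρ| + 1) :=
          mul_le_mul_of_nonneg_left h1 (by positivity)
      _ ≤ Q ^ 2 * N * (|ρ| + 1) := mul_le_mul_of_nonneg_right hQQ (by linarith [abs_nonneg ρ])
      _ = N * (|ρ| + 1) * Q ^ 2 := by ring
  have hlogΛ : Real.log Λ ≤ A₂ * Q ^ 2 := by
    rw [hΛ, hA₂]
    refine (log_mul_extra_le (by positivity) hW1).trans ?_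
    have h1 := log_Lambda_le hQ1 hA1 (by linarith) hD0 (Nat.cast_nonneg d) hdQ hQ.symm rfl rfl
      (K := (K : ℝ)) (A := A) (Dn := D) (dn := d) (n := r.den)
    have e : (2 + ((K : ℝ) + 1) + A + D + N * (|ρ| + 1)) * Q ^ 2 =
        (2 + ((K : ℝ) + 1) + A + D) * Q ^ 2 + N * (|ρ| + 1) * Q ^ 2 := by ring
    rw [e]
    exact add_le_add h1 hlogW
  have hlogΛ0 : 0 ≤ Real.log Λ := by
    refine Real.log_nonneg ?_
    rw [hΛ]
    have : (0 : ℝ) ≤ 2 ^ d * (A * Q ^ D) ^ r.den * W := by positivity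
    linarith
  have hE : (d : ℝ) * (211 * (Real.log Λ + 5 * d + 13) * (2 * d + 10) * (4 * (d : ℝ) ^ 2 + 7 * d + 1) +
      (Real.log Λ + d + 1)) ≤ A₃ * Q ^ 6 := by
    rw [hA₃]
    exact exponent_le_kummer hQ1 (by linarith) (by exact_mod_cast hd1) hdQ hA₂0 hlogΛ0 hlogΛ
  have hlow' : Real.exp (-(A₃ * Q ^ 6)) ≤ ‖aeval (((Real.log 2 : ℝ) : ℂ)) S‖ :=
    le_trans (Real.exp_le_exp.mpr (by linarith)) hlow
  -- (U) the upper bound: the product over the Kummer roots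
  obtain ⟨y, hy⟩ : ∃ y : ℂ, y = cexp (((Real.log 2 : ℝ) : ℂ) * ((r : ℝ) : ℂ)) := ⟨_, rfl⟩
  have hyq : y ^ r.den = (2 : ℂ) ^ pn := by
    rw [hy, ← Complex.exp_nat_mul, show (2 : ℂ) ^ pn = cexp ((pn : ℂ) * ((Real.log 2 : ℝ) : ℂ)) by
      rw [Complex.exp_nat_mul, cexp_log_two]]
    congr 1
    have e1 : ((r.den : ℕ) : ℂ) * ((r : ℝ) : ℂ) = (pn : ℂ) := by
      have h := Rat.den_mul_eq_num r
      have h' : ((r.den : ℚ) : ℂ) * ((r : ℚ) : ℂ) = ((r.num : ℚ) : ℂ) := by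
        rw [← Rat.cast_mul, h]
      rw [Complex.ofReal_ratCast]
      rw [Rat.cast_natCast, Rat.cast_intCast] at h'
      rw [h', ← hpnZ, Int.cast_natCast]
    calc ((r.den : ℕ) : ℂ) * ((((Real.log 2 : ℝ) : ℂ)) * ((r : ℝ) : ℂ))
        = ((Real.log 2 : ℝ) : ℂ) * (((r.den : ℕ) : ℂ) * ((r : ℝ) : ℂ)) := by ring
      _ = (pn : ℂ) * ((Real.log 2 : ℝ) : ℂ) := by rw [e1, mul_comm]
  have hexp2 : cexp (((Real.log 2 : ℝ) : ℂ)) ^ pn = (2 : ℂ) ^ pn := by rw [cexp_log_two]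
  have hymem : y ∈ (f.map (Int.castRingHom ℂ)).roots := (hmem_roots y).mpr hyq
  have hfac : ∀ b : ℂ, (conjFactor G b).eval (((Real.log 2 : ℝ) : ℂ)) =
      (r.den : ℂ) ^ D * MvPolynomial.aeval ![((r.num : ℂ) / r.den), ((Real.log 2 : ℝ) : ℂ), b] P := by
    intro b; rw [hGdef]; exact eval_conjFactor_torG P D r.num r.den hD hK hq0 b _
  have hrC : ((r : ℝ) : ℂ) = (r.num : ℂ) / r.den := by
    rw [Complex.ofReal_ratCast, Rat.cast_def]
  have hval : aeval (((Real.log 2 : ℝ) : ℂ)) S =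
      ((f.map (Int.castRingHom ℂ)).roots.map fun b =>
        (conjFactor G b).eval (((Real.log 2 : ℝ) : ℂ))).prod := by
    rw [hSdef, aeval_resPoly f G hGN, hlead, one_pow, one_mul]
  have hnormq : ‖((r.den : ℂ)) ^ D‖ = Q ^ D := by rw [norm_pow, Complex.norm_natCast, hQ]
  -- the special factor
  have hyfac : ‖(conjFactor G y).eval (((Real.log 2 : ℝ) : ℂ))‖ ≤ Q ^ D * (Kl * η) := by
    rw [hfac y, norm_mul, hnormq]
    refine mul_le_mul_of_nonneg_left ?_ (by positivity)
    have e1 : MvPolynomial.aeval ![((r.num : ℂ) / r.den), ((Real.log 2 : ℝ) : ℂ), y] P = kumF P r := by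
      rw [kumF_eq_aeval, hy, ← hrC]
    rw [e1, ← sub_zero (kumF P r), ← hFρ]
    have h1 : |(r : ℝ) - ρ| < δ₁ := by rw [abs_sub_comm, ← hηdef]; exact hηδ
    have h2 := hlip r h1
    rw [abs_sub_comm, ← hηdef] at h2
    exact h2
  -- the other factors
  have hofac : ∀ b ∈ (f.map (Int.castRingHom ℂ)).roots,
      ‖(conjFactor G b).eval (((Real.log 2 : ℝ) : ℂ))‖ ≤ Q ^ D * B' := by
    intro b hb
    rw [hfac b, norm_mul, hnormq]
    refine mul_le_mul_of_nonneg_left (le_trans ?_ hBB') (by positivity)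
    rw [hB]
    refine norm_mvaeval_le P _ ?_ ?_ ?_
    · show ‖((r.num : ℂ) / r.den)‖ ≤ |ρ| + 1
      rw [← hrC, Complex.norm_real, Real.norm_eq_abs]; exact hrabs
    · show ‖((Real.log 2 : ℝ) : ℂ)‖ ≤ 1
      rw [norm_log_two]; exact hlog2'
    · show ‖b‖ ≤ R₂
      exact hroot_norm b hb
  have hQB1 : 1 ≤ Q ^ D * B' := one_le_mul_of_one_le_of_one_le (one_le_pow₀ hQ1) hB'1
  have hup : ‖aeval (((Real.log 2 : ℝ) : ℂ)) S‖ ≤ (Q ^ D * B') ^ r.den * (Q ^ D * (Kl * η)) := by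
    rw [hval, ← Multiset.cons_erase hymem, Multiset.map_cons, Multiset.prod_cons, norm_mul, mul_comm]
    refine mul_le_mul ?_ hyfac (norm_nonneg _) (by positivity)
    refine (norm_multiset_map_prod_le _ (by positivity) _ fun b hb =>
      hofac b (Multiset.mem_of_mem_erase hb)).trans ?_
    refine pow_le_pow_right₀ hQB1 ?_
    exact (Multiset.card_erase_le).trans hcard
  -- (U') at most `exp(A₁ Q²) η`
  have hup' : (Q ^ D * B') ^ r.den * (Q ^ D * (Kl * η)) ≤ Real.exp (A₁ * Q ^ 2) * η := by
    rw [hA₁]; exact upper_exp hQ.symm hQ1 hB'1 hKl0 hη0.le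
  -- (E) endgame
  have hchain : Real.exp (-(A₃ * Q ^ 6)) < Real.exp (A₁ * Q ^ 2) * Real.exp (-(Q ^ 7)) := by
    calc Real.exp (-(A₃ * Q ^ 6)) ≤ ‖aeval (((Real.log 2 : ℝ) : ℂ)) S‖ := hlow'
      _ ≤ (Q ^ D * B') ^ r.den * (Q ^ D * (Kl * η)) := hup
      _ ≤ Real.exp (A₁ * Q ^ 2) * η := hup'
      _ < Real.exp (A₁ * Q ^ 2) * Real.exp (-(Q ^ 7)) :=
          mul_lt_mul_of_pos_left hη7 (Real.exp_pos _)
  rw [← Real.exp_add, Real.exp_lt_exp] at hchain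
  have hQA : A₁ + A₃ + 1 ≤ Q := by
    have hc : (⌈A₁ + A₃⌉₊ : ℝ) + 1 ≤ Q := by rw [hQ]; exact_mod_cast hqA
    linarith [Nat.le_ceil (A₁ + A₃)]
  exact endgame_kummer hQ1 hA₁0 hA₃0 hQA hchain

end HyperCell

end Summit.Schanuel.Schanuel.Theorems.RootDecomp1KHyper
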